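import Summits.KontsevichZagierPeriods.KontsevichZagierPeriods.Theorems.TerasomaMultiplicationBetaCancellationFibredPiCancellation
import Summits.KontsevichZagierPeriods.KontsevichZagierPeriods.Theorems.BetaCancellation.Negative.Torsion

/-!
# `BetaCancellation` (stmt-KontsevichZagierPeriods-13633), line `dirichlet-companion-to-pi` — stub `stub_sideFinishQuarter`

**Side-descent finish for the quarter band.** Write `D = piDisc` for the closed unit disc,
`L = D ∩ {-2 < x < 0}`, `R = D ∩ {0 < x < 2}` (the two open halves, as slab restrictions of `[π]`),
`S_A = D ∩ {-2 < x < -1/2}` (the `120°` segment) and let `DQ` be any representation with domain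
the quarter band `D ∩ {-1/2 < x < 0}` and integrand `1`. Assume the MIRROR move
`[D ∩ {x ∈ S}] − [D ∩ {-x ∈ S}] ∈ relations` (all `S`, integrand `1`). If `[DQ]·c` and `[π]·c` are
relations then so is `c`:

* mirror with `S = (-2, 0)`: `[L] − [R] ∈ relations` (`sideQuarter_slabL_domain`,
  `sideQuarter_slabR_domain`);
* domain additivity at the null chord `x = 0`: `[π] − [L] − [R] ∈ relations`
  (`sideQuarter_of_piRep_sub_of_slabs_mem`);
* domain additivity at the null chord `x = -1/2`: `[L] − [S_A] − [DQ] ∈ relations`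
  (`sideQuarter_of_slabL_sub_of_segA_sub_of_mem`);
* hence `2 • ([S_A]·c) = [π]·c − ([π] − [L] − [R])·c + ([L] − [R])·c − 2 • (([L] − [S_A] − [DQ])·c)
  − 2 • ([DQ]·c) ∈ relations` (right ideal, `KZ.mul_mem_relations_right_holds`), and
  `[S_A]·c ∈ relations` by TORSION-FREENESS (`BetaCancellationNegative.nsmul_mem_relations_iff`);
* the one-segment finish of seat c7: `[D ∩ {x > -1/2}]·c ∈ relations`
  (`of_piRep_sub_of_slabs_mem_relations`) and Archimedes' trisection
  (`stub_archimedesOfTriangle stub_triangleConst`).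

No definitions; sorry-free; axioms ⊆ {propext, Classical.choice, Quot.sound}.

References: M. Kontsevich, D. Zagier, *Periods* (2001), §1.2 rules (1)–(2).
-/

noncomputable section

-- `Summit.KontsevichZagierPeriods.KontsevichZagierPeriods.…` is the tree's mandated layout (single-conjunct summit).
set_option linter.dupNamespace false

namespace Summit.KontsevichZagierPeriods.KontsevichZagierPeriods.BetaCancellationLine

open Set MeasureTheory
open Literature.NumberTheory.Transcendental
open Literature.NumberTheory.Transcendental.KZ
open Summit.KontsevichZagierPeriods.KontsevichZagierPeriods.BetaCancellationNegative (volume_setOf_apply_eq_zero)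

/-! ### The two halves of the disc -/

/-- The left half `L = D ∩ {-2 < x < 0}` has domain `D ∩ {x ∈ (-2, 0)}`. [folklore] -/
theorem sideQuarter_slabL_domain :
    (piRep.slabRestrict (-2) 0).domain = piDisc ∩ {z | z 0 ∈ Set.Ioo (-2 : ℝ) 0} := by
  ext z
  simp only [IntegralRep.domain_slabRestrict, piRep_domain, mem_inter_iff, mem_paramSlab,
    mem_setOf_eq, mem_Ioo]
  push_cast
  constructor
  · rintro ⟨hd, h1, h2⟩
    exact ⟨hd, by linarith, by linarith⟩
  · rintro ⟨hd, h1, h2⟩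
    exact ⟨hd, by linarith, by linarith⟩

/-- The right half `R = D ∩ {0 < x < 2}` has domain `D ∩ {-x ∈ (-2, 0)}`. [folklore] -/
theorem sideQuarter_slabR_domain :
    (piRep.slabRestrict 0 2).domain = piDisc ∩ {z | -z 0 ∈ Set.Ioo (-2 : ℝ) 0} := by
  ext z
  simp only [IntegralRep.domain_slabRestrict, piRep_domain, mem_inter_iff, mem_paramSlab,
    mem_setOf_eq, mem_Ioo]
  push_cast
  constructor
  · rintro ⟨hd, h1, h2⟩
    exact ⟨hd, by linarith, by linarith⟩
  · rintro ⟨hd, h1, h2⟩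
    exact ⟨hd, by linarith, by linarith⟩

/-- **The disc is its two slab pieces at any rational abscissa `q`**:
`[D] − [D ∩ {-2 < x < q}] − [D ∩ {q < x < 2}] ∈ relations` (cutting `[π]` at the slab
`{q < x < 2}`; the complement is `D ∩ {-2 < x < q}` up to the null chord `x = q`). [folklore] -/
theorem sideQuarter_of_piRep_sub_of_slabs_mem (q : ℚ) :
    of piRep - of (piRep.slabRestrict (-2) q) - of (piRep.slabRestrict q 2) ∈ relations := by
  -- cut `[π]` at the slab `{q < x < 2}`
  have h1 := domainAddRel_subset_relations
    (IntegralRep.of_sub_of_slabRestrict_sub_of_slabCompl_mem piRep q 2)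
  -- the complement `D ∩ {x ≤ q}` is `D ∩ {-2 < x < q}` up to the null chord `x = q`
  have hsub : (piRep.slabRestrict (-2) q).domain ⊆ (piRep.slabCompl q 2).domain := by
    intro z hz
    rw [IntegralRep.domain_slabRestrict, piRep_domain, mem_inter_iff, mem_paramSlab] at hz
    rw [IntegralRep.domain_slabCompl, piRep_domain]
    refine ⟨hz.1, fun h => ?_⟩
    rw [mem_paramSlab] at h
    linarith [hz.2.2, h.1]
  have hvol : volume ((piRep.slabCompl q 2).domain \ (piRep.slabRestrict (-2) q).domain) = 0 := by
    refine measure_mono_null (fun z hz => ?_) (volume_setOf_apply_eq_zero (0 : Fin 2) (q : ℝ))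
    obtain ⟨hz1, hz2⟩ := hz
    rw [IntegralRep.domain_slabCompl, piRep_domain] at hz1
    obtain ⟨hd, hc⟩ := hz1
    rw [mem_piDisc] at hd
    rw [mem_paramSlab] at hc
    push_cast at hc
    have hle : z 0 ≤ 1 := by nlinarith [sq_nonneg (z 1), sq_nonneg (z 0 - 1)]
    have hge : -1 ≤ z 0 := by nlinarith [sq_nonneg (z 1), sq_nonneg (z 0 + 1)]
    have h1' : z 0 ≤ q := by
      by_contra h
      push Not at h
      exact hc ⟨h, by linarith⟩
    have h2' : (q : ℝ) ≤ z 0 := by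
      by_contra h
      push Not at h
      refine hz2 ?_
      rw [IntegralRep.domain_slabRestrict, piRep_domain, mem_inter_iff, mem_piDisc, mem_paramSlab]
      push_cast
      exact ⟨hd, by linarith, h⟩
    show z 0 = q
    exact le_antisymm h1' h2'
  have h2 := (piRep.slabCompl q 2).of_sub_of_restrict_mem_relations
    (piRep.slabRestrict (-2) q).isSemialgebraic_domain hsub hvol
  have e : (piRep.slabCompl q 2).restrict (piRep.slabRestrict (-2) q).domain
      (piRep.slabRestrict (-2) q).isSemialgebraic_domain hsub = piRep.slabRestrict (-2) q :=
    IntegralRep.ext' rfl rfl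
  rw [e] at h2
  have e2 : of piRep - of (piRep.slabRestrict (-2) q) - of (piRep.slabRestrict q 2) =
      (of piRep - of (piRep.slabRestrict q 2) - of (piRep.slabCompl q 2)) +
        (of (piRep.slabCompl q 2) - of (piRep.slabRestrict (-2) q)) := by abel
  rw [e2]
  exact relations.add_mem h1 h2

/-! ### The left half is the segment plus the quarter band -/

/-- **`[L] − [S_A] − [DQ] ∈ relations`**: cutting the left half `L = D ∩ {-2 < x < 0}` at the slab
`{-1/2 < x < 2}` gives the quarter band `DQ = D ∩ {-1/2 < x < 0}` and, up to the null chord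
`x = -1/2`, the segment `S_A = D ∩ {-2 < x < -1/2}`. [folklore] -/
theorem sideQuarter_of_slabL_sub_of_segA_sub_of_mem (DQ : IntegralRep 2)
    (hDQd : DQ.domain = piDisc ∩ {z | z 0 ∈ Set.Ioo (-1/2 : ℝ) 0})
    (hDQi : DQ.integrand = fun _ => 1) :
    of (piRep.slabRestrict (-2) 0) - of (piRep.slabRestrict (-2) (-1/2)) - of DQ ∈ relations := by
  -- cut `L` at the slab `{-1/2 < x < 2}`
  have h1 := domainAddRel_subset_relations
    (IntegralRep.of_sub_of_slabRestrict_sub_of_slabCompl_mem (piRep.slabRestrict (-2) 0) (-1/2) 2)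
  -- the slab piece IS the quarter band `DQ`
  have eQ : (piRep.slabRestrict (-2) 0).slabRestrict (-1/2) 2 = DQ := by
    refine IntegralRep.ext' ?_ ?_
    · rw [hDQd]
      ext z
      simp only [IntegralRep.domain_slabRestrict, piRep_domain, mem_inter_iff, mem_paramSlab,
        mem_setOf_eq, mem_Ioo]
      push_cast
      constructor
      · rintro ⟨⟨hd, -, h0⟩, hq, -⟩
        exact ⟨hd, by linarith, by linarith⟩
      · rintro ⟨hd, hq, h0⟩
        exact ⟨⟨hd, by linarith, by linarith⟩, by linarith, by linarith⟩
    · rw [IntegralRep.integrand_slabRestrict, IntegralRep.integrand_slabRestrict, piRep_integrand,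
        hDQi]
  rw [eQ] at h1
  -- the complement `L ∩ {x ≤ -1/2}` is `S_A` up to the null chord `x = -1/2`
  have hsub : (piRep.slabRestrict (-2) (-1/2)).domain ⊆
      ((piRep.slabRestrict (-2) 0).slabCompl (-1/2) 2).domain := by
    intro z hz
    rw [mem_segA_domain] at hz
    rw [IntegralRep.domain_slabCompl, IntegralRep.domain_slabRestrict, piRep_domain]
    refine ⟨⟨hz.1, ?_⟩, fun h => ?_⟩
    · rw [mem_paramSlab]
      push_cast
      exact ⟨hz.2.1, by linarith [hz.2.2]⟩
    · rw [mem_paramSlab] at h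
      push_cast at h
      linarith [hz.2.2, h.1]
  have hvol : volume (((piRep.slabRestrict (-2) 0).slabCompl (-1/2) 2).domain \
      (piRep.slabRestrict (-2) (-1/2)).domain) = 0 := by
    refine measure_mono_null (fun z hz => ?_) (volume_setOf_apply_eq_zero (0 : Fin 2) (-(1/2)))
    obtain ⟨hz1, hz2⟩ := hz
    rw [IntegralRep.domain_slabCompl, IntegralRep.domain_slabRestrict, piRep_domain] at hz1
    obtain ⟨⟨hd, hs⟩, hc⟩ := hz1
    rw [mem_piDisc] at hd
    rw [mem_paramSlab] at hs hc
    push_cast at hs hc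
    have h1' : z 0 ≤ -(1/2) := by
      by_contra h
      push Not at h
      exact hc ⟨by linarith, by linarith [hs.2]⟩
    have h2' : -(1/2) ≤ z 0 := by
      by_contra h
      push Not at h
      exact hz2 ((mem_segA_domain z).2 ⟨hd, by linarith [hs.1], by linarith⟩)
    show z 0 = -(1/2)
    exact le_antisymm h1' h2'
  have h2 := ((piRep.slabRestrict (-2) 0).slabCompl (-1/2) 2).of_sub_of_restrict_mem_relations
    (piRep.slabRestrict (-2) (-1/2)).isSemialgebraic_domain hsub hvol
  have e : ((piRep.slabRestrict (-2) 0).slabCompl (-1/2) 2).restrict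
      (piRep.slabRestrict (-2) (-1/2)).domain
      (piRep.slabRestrict (-2) (-1/2)).isSemialgebraic_domain hsub = piRep.slabRestrict (-2) (-1/2) :=
    IntegralRep.ext' rfl rfl
  rw [e] at h2
  have e2 : of (piRep.slabRestrict (-2) 0) - of (piRep.slabRestrict (-2) (-1/2)) - of DQ =
      (of (piRep.slabRestrict (-2) 0) - of DQ - of ((piRep.slabRestrict (-2) 0).slabCompl (-1/2) 2)) +
        (of ((piRep.slabRestrict (-2) 0).slabCompl (-1/2) 2) - of (piRep.slabRestrict (-2) (-1/2))) := by
    abel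
  rw [e2]
  exact relations.add_mem h1 h2

/-! ### The stub -/

/-- STUB (side-descent finish for the quarter band): if the mirror move is available, then
`[D ∩ {-1/2 < x < 0}]·c ∈ relations` and `[π]·c ∈ relations` force `c ∈ relations`
(halves `[D ∩ {x<0}] ∼ [D ∩ {x>0}]` by the mirror and torsion-freeness, then
`[S_A] = [D ∩ {x<0}] − [quarter]`, Archimedes). [folklore] -/
theorem stub_sideFinishQuarter :
    (∀ (S : Set ℝ) (DS DS' : IntegralRep 2), DS.domain = piDisc ∩ {z | z 0 ∈ S} → DS'.domain = piDisc ∩ {z | -z 0 ∈ S} → (DS.integrand = fun _ => 1) → (DS'.integrand = fun _ => 1) → of DS - of DS' ∈ relations) → ∀ (DQ : IntegralRep 2), DQ.domain = piDisc ∩ {z | z 0 ∈ Set.Ioo (-1/2 : ℝ) 0} → (DQ.integrand = fun _ => 1) → ∀ c : FormalRep, of DQ * c ∈ relations → of piRep * c ∈ relations → c ∈ relations := by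
  intro hM DQ hDQd hDQi c hQ hc
  -- the mirror with `S = (-2, 0)`: `[L] − [R] ∈ relations`
  have hLR : of (piRep.slabRestrict (-2) 0) - of (piRep.slabRestrict 0 2) ∈ relations :=
    hM (Set.Ioo (-2 : ℝ) 0) (piRep.slabRestrict (-2) 0) (piRep.slabRestrict 0 2)
      sideQuarter_slabL_domain sideQuarter_slabR_domain rfl rfl
  -- the disc is its two halves: `[π] − [L] − [R] ∈ relations`
  have hπ : of piRep - of (piRep.slabRestrict (-2) 0) - of (piRep.slabRestrict 0 2) ∈ relations :=
    sideQuarter_of_piRep_sub_of_slabs_mem 0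
  -- the left half is the segment plus the quarter band: `[L] − [S_A] − [DQ] ∈ relations`
  have hLQ : of (piRep.slabRestrict (-2) 0) - of (piRep.slabRestrict (-2) (-1/2)) - of DQ ∈
      relations :=
    sideQuarter_of_slabL_sub_of_segA_sub_of_mem DQ hDQd hDQi
  -- `2 • [S_A]·c` is a combination of the five relations at hand
  have key : 2 • (of (piRep.slabRestrict (-2) (-1/2)) * c) =
      of piRep * c
        - (of piRep - of (piRep.slabRestrict (-2) 0) - of (piRep.slabRestrict 0 2)) * c
        + (of (piRep.slabRestrict (-2) 0) - of (piRep.slabRestrict 0 2)) * c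
        - 2 • ((of (piRep.slabRestrict (-2) 0) - of (piRep.slabRestrict (-2) (-1/2)) - of DQ) * c)
        - 2 • (of DQ * c) := by
    simp only [sub_mul, two_nsmul]
    abel
  have h2A : 2 • (of (piRep.slabRestrict (-2) (-1/2)) * c) ∈ relations := by
    rw [key]
    exact relations.sub_mem (relations.sub_mem (relations.add_mem (relations.sub_mem hc
      (mul_mem_relations_right_holds _ c hπ)) (mul_mem_relations_right_holds _ c hLR))
      (relations.nsmul_mem (mul_mem_relations_right_holds _ c hLQ) 2)) (relations.nsmul_mem hQ 2)
  -- torsion-freeness: `[S_A]·c ∈ relations`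
  have hA : of (piRep.slabRestrict (-2) (-1/2)) * c ∈ relations :=
    (Summit.KontsevichZagierPeriods.KontsevichZagierPeriods.BetaCancellationNegative.nsmul_mem_relations_iff
      two_ne_zero _).1 h2A
  -- the one-segment finish (seat c7): `[D ∩ {x > -1/2}]·c ∈ relations`, then Archimedes
  have hX := mul_mem_relations_right_holds _ c of_piRep_sub_of_slabs_mem_relations
  have hD : of (piRep.slabRestrict (-1/2) 2) * c ∈ relations := by
    have e : of (piRep.slabRestrict (-1/2) 2) * c =
        of piRep * c - of (piRep.slabRestrict (-2) (-1/2)) * c -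
          (of piRep - of (piRep.slabRestrict (-2) (-1/2)) - of (piRep.slabRestrict (-1/2) 2)) * c := by
      simp only [sub_mul]; abel
    rw [e]
    exact relations.sub_mem (relations.sub_mem hc hA) hX
  exact stub_archimedesOfTriangle stub_triangleConst c hA hD

end Summit.KontsevichZagierPeriods.KontsevichZagierPeriods.BetaCancellationLine
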